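import Literature.MathematicalPhysics.QuantumFieldTheory.Balaban1983to89.B9Thm39ReadingAtLetters
import Literature.MathematicalPhysics.QuantumFieldTheory.Balaban1983to89.B9Thm311PosAtRecordV4
import Literature.MathematicalPhysics.QuantumFieldTheory.Balaban1983to89.B9BackgroundsKLevelV1R

/-!
# `Balaban1983to89.B9Thm39Thm311AtLettersR` — rows 15–16 ([B9] Theorem 3.9 ⇒ Theorem 3.2) and row 17 ([B9] Theorem 3.11) of the N06 knit at def-Y's
# letters, RE-PRESSED ONCE over the CLASS-PARAMETRIC background carrier `bg9YR 𝔸 G R₁ R₂` (MODULE 3-R `B9BackgroundsKLevelV1R`)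

T. Bałaban, *Propagators for lattice gauge theories in a background field*, Commun. Math. Phys. **99** (1985) 389–434
[`Balaban1985BackgroundPropagators`, "B9"]; [4] = T. Bałaban, *Propagators and renormalization transformations for lattice gauge theories. II*,
Commun. Math. Phys. **96** (1984) 223–250 [`Balaban1984PropagatorsII`].

statement-level skeleton of published theorems with citation tags; proofs where landed; nothing here is a claim about the
Yang–Mills mass gap

WHY THIS FILE (pub-ymgap bus, dag-lead CASCADE-R; def-Y's recipe).  The N06 certificate consumes rows 15–16 through
`B9Thm39ReadingAtLetters.t39_hksum_of_pins_opsYOfLetters` and row 17 through `B9Thm311PosAtRecordV4.t311_of_pins_opsYOfLettersV4₁`; both STATEMENTS pin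
MODULE 3's member carrier `bg9Y` NON-TRANSPARENTLY — as the backgrounds-family argument of `B9.Thm39Printed` ∕ `B9.RWKernelSumYields` ∕ `B9.Thm311Printed`
and under `.Reg335` in the displayed provisos `h39` ∕ `hΔA` — so they do not transfer by `exact` to an edition of the certificate over another reading of
the cube class (3.35)–(3.36) (print's class `bg9YP`, or any later amendment).  MODULE 3-R types the carrier ONCE over a PARAMETER `(R₁, R₂)` of
regularity-predicate families (`bg9YR 𝔸 G R₁ R₂ x`; `bg9Y x = bg9YR … (regY335 …) (regY336 …) x` and `bg9YP x = bg9YR … (regYP335 …) (regYP336 …) x` by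
`rfl`) with fieldwise re-typings of the operator records (`rwKernelExpansionR`, `siteKernelR`, …; same entries).  THIS FILE re-presses the two faces at
generic `(R₁, R₂)` — same proof texts, `bg9Y ↦ bg9YR 𝔸 G R₁ R₂` in the leaf binders, the kernels of the conclusions read through `rwKernelExpansionR R₁ R₂`
∕ `siteKernelR R₁ R₂` (exactly the `.EK39 ∕ .Cinv ∕ .PosDef` slots of MODULE 5-R's `carriersYR R₁ R₂ ops`), and the ONE place where the landed proof READS
the class — «U is `SU(N)`-valued» (`hU.1.1`, for Δ′_a(U) > 0 and the (3.13) adjointness in row 17) — taken as the displayed class axiom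
`(hG : MemOfFam (specialUnitaryUnits (Fin N)) R₁)` (MODULE 3-R; discharged at both readings by `memOfFam_regY335 ∕ memOfFam_regYP335`).  Rows 15–16
read NO class datum (the carrier-kernel reading `reading_le_of_letters` and [4] (2.61) `rowSum261_geo9Y` are class-free), so their twin carries no
class axiom at all.

* §1 `kerReadsLeVia_opsYOfLettersR` — the carrier-kernel reading `KerReadsLeVia` at def-Y's operator layer for Theorem-3.9 carrier letters typed over
  `bg9YR … R₁ R₂ x` and the re-typed kernel `siteKernelR R₁ R₂ (ops x).Cinv` (= `reading_le_of_letters` read through the fieldwise re-typing);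
  ★★ `t39_hksum_of_pins_opsYOfLettersR` — ROWS 15 ∧ 16 at generic `(R₁, R₂)`: `B9.Thm39Printed (θ.d₆+1) c35Y geo9Y (bg9YR … R₁ R₂) (fun x =>
  rwKernelExpansionR R₁ R₂ ((opsYOfLetters N θ M⋆ 𝔏 𝔈) x).EK39) ∧ B9.RWKernelSumYields … (fun x => siteKernelR R₁ R₂ ((opsYOfLetters …) x).Cinv)` from the
  rows-15–16 binders of the certificate with `𝔬39 x : Ops39Blk (geo9Y x) (bg9YR … R₁ R₂ x) …`, `rd39 x : WalkReading39 (bg9YR … x) …`, `h39`'s proviso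
  `(bg9YR … R₁ R₂ x).Reg335 c35Y α₀ U` and the pin `hEK39 : rwKernelExpansionR R₁ R₂ ((ops …) x).EK39 = EK39OfOpsBlkVia (𝔬39 x) (rd39 x) …` (all other
  binders verbatim); ★ `t39_hksum_of_pins_opsYOfLetters_P` — the face at PRINT's class `bg9YP` (the R face at `(regYP335, regYP336)`, by `exact`).  At MODULE 3's
  families `(regY335, regY336)` the R face IS the landed `t39_hksum_of_pins_opsYOfLetters` by `exact` (coherence; checked in the seat's probe, not re-filed — dedup).
* §2 ★★ `t311_of_pins_opsYOfLettersV4₁R` — ROW 17 at generic `(R₁, R₂)`: `B9.Thm311Printed c35Y geo9Y (bg9YR … R₁ R₂) (fun x => ((opsYOfLetters N θ M⋆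
  (lettersYOfRecordV4 …) 𝔈) x).PosDef)` from the pin `hPD` VERBATIM, the class axiom `hG` and the ONE displayed clause `hΔA` («Δ_a(U) positive definite»)
  with proviso `(bg9YR … R₁ R₂ x).Reg335 c35Y α₀ U`; the chain is the landed one (`inputs311Y₄_of_posDefTr_deltaAY` → `inputs311Y₅_of_four` →
  `inputs311Y_of_five` → `inputs311_ops311Y` → `posDefOfOps_all`) with `hU.1.1 ↦ mem_of_reg335R hG x hU`; ★ `t311_of_pins_opsYOfLettersV4₁_P` (row 17 at
  PRINT's class `bg9YP`, `memOfFam_regYP335`, by `exact`).  At `(regY335, regY336)` with `memOfFam_regY335` the R face IS the landed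
  `t311_of_pins_opsYOfLettersV4₁` by `exact` (coherence; checked in the seat's probe, not re-filed — dedup).

CONSUMER: dag-n06-d's certificate EDITION 8 at `carriersYR … R₁ R₂ ops` (MODULE 5-R `B9PinCarriersKLevelV1R.b9LeafX_carriersYR`: leaves
`t39 : B9.Thm39Printed (d+1) c35Y geo9Y (bg9YR 𝔸 G R₁ R₂) (fun x => rwKernelExpansionR R₁ R₂ (ops x).EK39)`, `hksum : B9.RWKernelSumYields … (fun x =>
siteKernelR R₁ R₂ (ops x).Cinv)`, `t311 : B9.Thm311Printed c35Y geo9Y (bg9YR 𝔸 G R₁ R₂) (fun x => (ops x).PosDef)` — exactly the conclusions below at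
`ops := opsYOfLetters …`).  At print's class the clause `hΔA` of §2 follows from the principal coercivity alone
(`B9Eq335CoveragePAtLettersY.posDefTr_deltaAY_member_of_principal_P`); at generic `(R₁, R₂)` it stays displayed.
HONEST SCOPE.  Kernel-typing bookkeeping over the landed faces; every Theorem-3.9 schema and the clause «Δ_a(U) > 0 on (3.35)» stay DISPLAYED hypotheses
of printed shape; nothing of [B9] or [4] is asserted; NOT a node discharge, NOT summit progress; count-neutral; one finite 𝕋⁴ programme — nothing
continuum, nothing about the mass gap.  Cell `pub-ymgap` (HUMAN RULING D-0062), Track A node N06 [B9], seat `pub-ymgap-dag-n06-j` (harness re-seat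
gen 12), 2026-08-27.  No `sorry`, no `axiom`, no `instance`, no `notation`, no `def`.
-/

namespace Literature.MathematicalPhysics.QuantumFieldTheory.Balaban1983to89.B9Thm39Thm311AtLettersR

open Literature.MathematicalPhysics.QuantumFieldTheory.Balaban1983to89
open B9Thm39Whole B9Thm39WholeBlk B9Thm39WholeBlkVia B9Thm39WholeBlkViaDatum B9Thm39ReadingCoords B9Thm39ReadingAtLetters
open B9Thm311Whole B9Thm311ReadingCoords B9Thm311ReadingAtLetters B9Thm311SymmAtRecordV4 B9Thm311PosAtRecordV4 Node00
open B6KLevelCensusIndexV1 B9PinMembersKLevelV1 B9PinCarriersKLevelV1 B9PinGeometryKLevelV1 B7Prop2SpecialUnitary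
open B9BackgroundsKLevelV1R B9GeoLemma21KLevelV1

noncomputable section

/-! ## §1 Rows 15 ∧ 16 at generic `(R₁, R₂)` -/

section Rows1516

open scoped Matrix.Norms.L2Operator

variable {N : ℕ} (θ : Stage3Params) (Mstar : ℕ) (𝔏 : LettersY N θ Mstar) (𝔈 : ExpsY N θ Mstar)
variable [∀ x : MemberY θ.d₆ θ.ℓ₆ θ.hd' θ.hL' θ.b₀ θ.b₁ Mstar, Fintype (geo9Y x).Site]
  [∀ x : MemberY θ.d₆ θ.ℓ₆ θ.hd' θ.hL' θ.b₀ θ.b₁ Mstar, DecidableEq (geo9Y x).Site]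
variable {ι κ : MemberY θ.d₆ θ.ℓ₆ θ.hd' θ.hL' θ.b₀ θ.b₁ Mstar → Type} [∀ x, Fintype (ι x)]
variable (R₁ R₂ : RegFamY θ.d₆ θ.ℓ₆ θ.hd' θ.hL' θ.b₀ θ.b₁ Mstar (Matrix (Fin N) (Fin N) ℂ))

omit [∀ x : MemberY θ.d₆ θ.ℓ₆ θ.hd' θ.hL' θ.b₀ θ.b₁ Mstar, Fintype (geo9Y x).Site] [∀ x, Fintype (ι x)] in
/-- ★ **THE CARRIER-KERNEL READING AT def-Y's OPERATOR LAYER, CLASS-PARAMETRIC TYPING**: for Theorem-3.9 carrier letters `𝔬39 x` typed over the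
class-parametric carrier `bg9YR … R₁ R₂ x` (same configurations as `bg9Y`, MODULE 3-R `bg9YR_Cfg_eq`) and pinned to `blk39` ∕ `L39`, the reading
`KerReadsLeVia (𝔬39 x) (siteKernelR R₁ R₂ (ops x).Cinv) (θ.d₆+1) (cR39 …) (repSite39 …)` at `ops := opsYOfLetters N θ M⋆ 𝔏 𝔈` — `reading_le_of_letters` read
through the fieldwise re-typing of the carrier letters (same block map, same `L(U)`; the re-typed kernel has the same entries, `siteKernelR_ker`).
No class datum is read. [cite: Balaban1985BackgroundPropagators, Thm 3.2 (3.48) p.398 + (3.25) p.395 + (3.96) p.411; Balaban1984PropagatorsII, (2.51) p.232 + p.248] -/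
theorem kerReadsLeVia_opsYOfLettersR
    (hC : ∀ x : MemberY θ.d₆ θ.ℓ₆ θ.hd' θ.hL' θ.b₀ θ.b₁ Mstar, (𝔏 x).C = CY x.toKIdx (𝔏 x).parS (𝔏 x).Gp)
    (𝔬39 : ∀ x : MemberY θ.d₆ θ.ℓ₆ θ.hd' θ.hL' θ.b₀ θ.b₁ Mstar,
      Ops39Blk (geo9Y x) (bg9YR (Matrix (Fin N) (Fin N) ℂ) (specialUnitaryUnits (Fin N)) R₁ R₂ x) (X39 (Matrix (Fin N) (Fin N) ℂ) x.toKIdx)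
        (ι x) (κ x))
    (hblk : ∀ x, (𝔬39 x).blk = blk39 (Matrix (Fin N) (Fin N) ℂ) x.toKIdx)
    (hL : ∀ x, (𝔬39 x).L = L39 x.toKIdx (𝔏 x).parS (𝔏 x).Gp) (x : MemberY θ.d₆ θ.ℓ₆ θ.hd' θ.hL' θ.b₀ θ.b₁ Mstar) :
    KerReadsLeVia (𝔬39 x) (siteKernelR R₁ R₂ ((opsYOfLetters N θ Mstar 𝔏 𝔈) x).Cinv) (θ.d₆ + 1) (cR39 (basis39 (Matrix (Fin N) (Fin N) ℂ)))
      (repSite39 x.toKIdx) :=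
  fun U T hTL hLT y y' =>
    reading_le_of_letters x (𝔏 x) (𝔈 x) (hC x)
      ⟨(𝔬39 x).blk, (𝔬39 x).S, (𝔬39 x).h, (𝔬39 x).chi, (𝔬39 x).L, (𝔬39 x).Lloc, (𝔬39 x).Cl, (𝔬39 x).Sw, (𝔬39 x).Rw⟩
      (hblk x) (hL x) U T hTL hLT y y'

/-- ★★ **ROWS 15 ∧ 16 OF THE N06 KNIT AT def-Y's INSTANCE, RE-PRESSED ONCE AT GENERIC `(R₁, R₂)`** (the twin of `t39_hksum_of_pins_opsYOfLetters` for every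
reading of the cube class): for every letters family `𝔏` with `(𝔏 x).C = CY x.toKIdx (𝔏 x).parS (𝔏 x).Gp` and expansion letters `𝔈`, Theorem-3.9 carrier
letters `𝔬39 x : Ops39Blk (geo9Y x) (bg9YR … R₁ R₂ x) (X39 M_N(ℂ) x.toKIdx) (ι x) (κ x)` read by `rd39`, pinned by `(𝔬39 x).blk = blk39 …`, `(𝔬39 x).L = L39 …`
(the GENUINE (Q′G′²Q′*)(U)) and `rwKernelExpansionR R₁ R₂ ((ops x).EK39) = EK39OfOpsBlkVia (𝔬39 x) (rd39 x) (θ.d₆+1) (2(N₀·B₀)·rowConst261 geo9Y (α′r))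
((1−α′)r) (repSite39 x.toKIdx)`, satisfying the printed-shape schemas under the proviso `(bg9YR … R₁ R₂ x).Reg335 c35Y α₀ U` (= `R₁ x c35Y α₀ U`):
`B9.Thm39Printed … (bg9YR … R₁ R₂) (fun x => rwKernelExpansionR R₁ R₂ (ops x).EK39)` ∧ `B9.RWKernelSumYields … (fun x => rwKernelExpansionR R₁ R₂ (ops x).EK39)
(fun x => siteKernelR R₁ R₂ (ops x).Cinv)` at `ops := opsYOfLetters N θ M⋆ 𝔏 𝔈` — exactly the `t39 ∕ hksum` leaves of MODULE 5-R's knit at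
`carriersYR … R₁ R₂ ops`; [4] (2.61) by `rowSum261_geo9Y`, the reading by `kerReadsLeVia_opsYOfLettersR`; NO class axiom.
[cite: Balaban1985BackgroundPropagators, Thm 3.9 (3.98)–(3.99) p.413 + Thm 3.2 (3.48) p.398 + (3.25) p.395 + (3.35) p.396; Balaban1984PropagatorsII, Lemma 2.1 (2.61) p.234 + (2.51) p.232 + p.248] -/
theorem t39_hksum_of_pins_opsYOfLettersR
    (𝔬39 : ∀ x : MemberY θ.d₆ θ.ℓ₆ θ.hd' θ.hL' θ.b₀ θ.b₁ Mstar,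
      Ops39Blk (geo9Y x) (bg9YR (Matrix (Fin N) (Fin N) ℂ) (specialUnitaryUnits (Fin N)) R₁ R₂ x) (X39 (Matrix (Fin N) (Fin N) ℂ) x.toKIdx)
        (ι x) (κ x))
    (rd39 : ∀ x : MemberY θ.d₆ θ.ℓ₆ θ.hd' θ.hL' θ.b₀ θ.b₁ Mstar,
      WalkReading39 (bg9YR (Matrix (Fin N) (Fin N) ℂ) (specialUnitaryUnits (Fin N)) R₁ R₂ x) (ι x) (κ x))
    (α α' r δ₀ θ₀ B₀ N₀ a₁ M₁ : ℝ)
    (hα : 0 < α) (hα1 : α < 1) (hα'0 : 0 < α') (hα'1 : α' < 1) (hr : 0 < r) (hrδ : r ≤ δ₀) (hθ₀ : 0 ≤ θ₀) (hB₀ : 0 < B₀)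
    (hN₀ : 0 ≤ N₀) (ha₁ : 0 < a₁) (hM₁ : 0 < M₁)
    (hst : ∀ x, StaticOK39Blk (𝔬39 x) N₀) (hloc : ∀ x, Locality39Blk (𝔬39 x) (rd39 x))
    (h39 : ∀ x : MemberY θ.d₆ θ.ℓ₆ θ.hd' θ.hL' θ.b₀ θ.b₁ Mstar, M₁ ≤ (geo9Y x).M → ∀ α₀ : ℝ, 0 < α₀ → c35Y * (geo9Y x).M * α₀ ≤ a₁ →
      ∀ U : (bg9YR (Matrix (Fin N) (Fin N) ℂ) (specialUnitaryUnits (Fin N)) R₁ R₂ x).Cfg,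
        (bg9YR (Matrix (Fin N) (Fin N) ℂ) (specialUnitaryUnits (Fin N)) R₁ R₂ x).Reg335 c35Y α₀ U →
        Local348Blk (𝔬39 x) B₀ δ₀ U ∧ Identities395Blk (𝔬39 x) U ∧ Small285Blk (𝔬39 x) θ₀ r U ∧ Factors389Blk (𝔬39 x) θ₀ δ₀ U)
    (hC : ∀ x : MemberY θ.d₆ θ.ℓ₆ θ.hd' θ.hL' θ.b₀ θ.b₁ Mstar, (𝔏 x).C = CY x.toKIdx (𝔏 x).parS (𝔏 x).Gp)
    (hblk : ∀ x, (𝔬39 x).blk = blk39 (Matrix (Fin N) (Fin N) ℂ) x.toKIdx)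
    (hL : ∀ x, (𝔬39 x).L = L39 x.toKIdx (𝔏 x).parS (𝔏 x).Gp)
    (hEK39 : ∀ x : MemberY θ.d₆ θ.ℓ₆ θ.hd' θ.hL' θ.b₀ θ.b₁ Mstar, rwKernelExpansionR R₁ R₂ ((opsYOfLetters N θ Mstar 𝔏 𝔈) x).EK39 =
      EK39OfOpsBlkVia (𝔬39 x) (rd39 x) (θ.d₆ + 1)
        (2 * (N₀ * B₀) * B9RowSum261DefiniteFaces.rowConst261 (geo9Y (d := θ.d₆) (ℓ := θ.ℓ₆) (hd := θ.hd') (hL := θ.hL')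
          (b₀ := θ.b₀) (b₁ := θ.b₁) (Mstar := Mstar)) (α' * r)) ((1 - α') * r) (repSite39 x.toKIdx)) :
    B9.Thm39Printed (θ.d₆ + 1) c35Y geo9Y (bg9YR (Matrix (Fin N) (Fin N) ℂ) (specialUnitaryUnits (Fin N)) R₁ R₂)
        (fun x => rwKernelExpansionR R₁ R₂ ((opsYOfLetters N θ Mstar 𝔏 𝔈) x).EK39) ∧
      B9.RWKernelSumYields (θ.d₆ + 1) geo9Y (bg9YR (Matrix (Fin N) (Fin N) ℂ) (specialUnitaryUnits (Fin N)) R₁ R₂)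
        (fun x => rwKernelExpansionR R₁ R₂ ((opsYOfLetters N θ Mstar 𝔏 𝔈) x).EK39)
        (fun x => siteKernelR R₁ R₂ ((opsYOfLetters N θ Mstar 𝔏 𝔈) x).Cinv) :=
  thm39_and_kernelSum_of_pin_rowConst261BlkViaDatum 𝔬39 rd39 (fun x => siteKernelR R₁ R₂ ((opsYOfLetters N θ Mstar 𝔏 𝔈) x).Cinv)
    (θ.d₆ + 1) (fun x => repSite39 x.toKIdx) α α' r δ₀ θ₀ B₀ N₀ a₁ M₁ (cR39 (basis39 (Matrix (Fin N) (Fin N) ℂ))) c35Y_pos hα hα1 hα'0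
    hα'1 hr hrδ hθ₀ hB₀ hN₀ ha₁ hM₁ (cR39_nonneg _) hst hloc rowSum261_geo9Y (fun x y => len_repSite39 x.toKIdx y)
    (fun x y z => dist_repSite39_left x.toKIdx y z) (fun x z y => dist_repSite39_right x.toKIdx z y)
    (kerReadsLeVia_opsYOfLettersR θ Mstar 𝔏 𝔈 R₁ R₂ hC 𝔬39 hblk hL) h39 hEK39

/-- ★ **THE FACE AT PRINT's CLASS** (`bg9YP`, MODULE 3-P; «a number ≧ 10»): at `(R₁, R₂) := (regYP335, regYP336)` the class-parametric face reads, by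
`rfl` (`bg9YP_eq_bg9YR`), rows 15 ∧ 16 over print's cube class — the specialisation dag-n06-d's edition 8 performs at the certificate level.
[cite: Balaban1985BackgroundPropagators, Thm 3.9 p.413 + (3.35) p.396 («a number ≧ 10»; bookkeeping)] -/
theorem t39_hksum_of_pins_opsYOfLetters_P
    (𝔬39 : ∀ x : MemberY θ.d₆ θ.ℓ₆ θ.hd' θ.hL' θ.b₀ θ.b₁ Mstar,
      Ops39Blk (geo9Y x) (B9BackgroundsKLevelV1P.bg9YP (Matrix (Fin N) (Fin N) ℂ) (specialUnitaryUnits (Fin N)) x) (X39 (Matrix (Fin N) (Fin N) ℂ) x.toKIdx) (ι x) (κ x))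
    (rd39 : ∀ x : MemberY θ.d₆ θ.ℓ₆ θ.hd' θ.hL' θ.b₀ θ.b₁ Mstar,
      WalkReading39 (B9BackgroundsKLevelV1P.bg9YP (Matrix (Fin N) (Fin N) ℂ) (specialUnitaryUnits (Fin N)) x) (ι x) (κ x))
    (α α' r δ₀ θ₀ B₀ N₀ a₁ M₁ : ℝ)
    (hα : 0 < α) (hα1 : α < 1) (hα'0 : 0 < α') (hα'1 : α' < 1) (hr : 0 < r) (hrδ : r ≤ δ₀) (hθ₀ : 0 ≤ θ₀) (hB₀ : 0 < B₀)
    (hN₀ : 0 ≤ N₀) (ha₁ : 0 < a₁) (hM₁ : 0 < M₁)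
    (hst : ∀ x, StaticOK39Blk (𝔬39 x) N₀) (hloc : ∀ x, Locality39Blk (𝔬39 x) (rd39 x))
    (h39 : ∀ x : MemberY θ.d₆ θ.ℓ₆ θ.hd' θ.hL' θ.b₀ θ.b₁ Mstar, M₁ ≤ (geo9Y x).M → ∀ α₀ : ℝ, 0 < α₀ → c35Y * (geo9Y x).M * α₀ ≤ a₁ →
      ∀ U : (B9BackgroundsKLevelV1P.bg9YP (Matrix (Fin N) (Fin N) ℂ) (specialUnitaryUnits (Fin N)) x).Cfg,
        (B9BackgroundsKLevelV1P.bg9YP (Matrix (Fin N) (Fin N) ℂ) (specialUnitaryUnits (Fin N)) x).Reg335 c35Y α₀ U →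
        Local348Blk (𝔬39 x) B₀ δ₀ U ∧ Identities395Blk (𝔬39 x) U ∧ Small285Blk (𝔬39 x) θ₀ r U ∧ Factors389Blk (𝔬39 x) θ₀ δ₀ U)
    (hC : ∀ x : MemberY θ.d₆ θ.ℓ₆ θ.hd' θ.hL' θ.b₀ θ.b₁ Mstar, (𝔏 x).C = CY x.toKIdx (𝔏 x).parS (𝔏 x).Gp)
    (hblk : ∀ x, (𝔬39 x).blk = blk39 (Matrix (Fin N) (Fin N) ℂ) x.toKIdx)
    (hL : ∀ x, (𝔬39 x).L = L39 x.toKIdx (𝔏 x).parS (𝔏 x).Gp)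
    (hEK39 : ∀ x : MemberY θ.d₆ θ.ℓ₆ θ.hd' θ.hL' θ.b₀ θ.b₁ Mstar,
      rwKernelExpansionR (regYP335 (Matrix (Fin N) (Fin N) ℂ) (specialUnitaryUnits (Fin N)))
        (regYP336 (Matrix (Fin N) (Fin N) ℂ) (specialUnitaryUnits (Fin N))) ((opsYOfLetters N θ Mstar 𝔏 𝔈) x).EK39 =
      EK39OfOpsBlkVia (𝔬39 x) (rd39 x) (θ.d₆ + 1)
        (2 * (N₀ * B₀) * B9RowSum261DefiniteFaces.rowConst261 (geo9Y (d := θ.d₆) (ℓ := θ.ℓ₆) (hd := θ.hd') (hL := θ.hL')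
          (b₀ := θ.b₀) (b₁ := θ.b₁) (Mstar := Mstar)) (α' * r)) ((1 - α') * r) (repSite39 x.toKIdx)) :
    B9.Thm39Printed (θ.d₆ + 1) c35Y geo9Y (B9BackgroundsKLevelV1P.bg9YP (Matrix (Fin N) (Fin N) ℂ) (specialUnitaryUnits (Fin N)))
        (fun x => rwKernelExpansionR (regYP335 (Matrix (Fin N) (Fin N) ℂ) (specialUnitaryUnits (Fin N)))
          (regYP336 (Matrix (Fin N) (Fin N) ℂ) (specialUnitaryUnits (Fin N))) ((opsYOfLetters N θ Mstar 𝔏 𝔈) x).EK39) ∧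
      B9.RWKernelSumYields (θ.d₆ + 1) geo9Y (B9BackgroundsKLevelV1P.bg9YP (Matrix (Fin N) (Fin N) ℂ) (specialUnitaryUnits (Fin N)))
        (fun x => rwKernelExpansionR (regYP335 (Matrix (Fin N) (Fin N) ℂ) (specialUnitaryUnits (Fin N)))
          (regYP336 (Matrix (Fin N) (Fin N) ℂ) (specialUnitaryUnits (Fin N))) ((opsYOfLetters N θ Mstar 𝔏 𝔈) x).EK39)
        (fun x => siteKernelR (regYP335 (Matrix (Fin N) (Fin N) ℂ) (specialUnitaryUnits (Fin N)))
          (regYP336 (Matrix (Fin N) (Fin N) ℂ) (specialUnitaryUnits (Fin N))) ((opsYOfLetters N θ Mstar 𝔏 𝔈) x).Cinv) :=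
  t39_hksum_of_pins_opsYOfLettersR θ Mstar 𝔏 𝔈
    (regYP335 (Matrix (Fin N) (Fin N) ℂ) (specialUnitaryUnits (Fin N))) (regYP336 (Matrix (Fin N) (Fin N) ℂ) (specialUnitaryUnits (Fin N)))
    𝔬39 rd39 α α' r δ₀ θ₀ B₀ N₀ a₁ M₁ hα hα1 hα'0 hα'1 hr hrδ hθ₀ hB₀ hN₀ ha₁ hM₁ hst hloc h39 hC hblk hL hEK39

end Rows1516

/-! ## §2 Row 17 at generic `(R₁, R₂)` -/

section Row17

open scoped Matrix.Norms.L2Operator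

variable {N : ℕ} (θ : Stage3Params) (Mstar : ℕ) (𝔯 : ResY N θ Mstar) (𝔈 : ExpsY N θ Mstar)
variable (R₁ R₂ : RegFamY θ.d₆ θ.ℓ₆ θ.hd' θ.hL' θ.b₀ θ.b₁ Mstar (Matrix (Fin N) (Fin N) ℂ))

/-- ★★ **ROW 17 OF THE N06 KNIT AT def-Y's v4 LETTERS, RE-PRESSED ONCE AT GENERIC `(R₁, R₂)`** (the twin of `t311_of_pins_opsYOfLettersV4₁` for every
reading of the cube class): from the pin `hPD` (VERBATIM), the displayed class axiom `hG : MemOfFam SU(N) R₁` (a configuration in the class is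
`SU(N)`-valued — what the landed chain reads for «Δ′_a(U) positive definite» (3.24) and the (3.13) adjointness) and the ONE displayed clause `hΔA`
(«Δ_a(U) positive definite» under the provisos M ≧ M₁, 0 < α₀, Mα₀ ≦ a₁ and `(bg9YR … R₁ R₂ x).Reg335 c35Y α₀ U` = `R₁ x c35Y α₀ U`):
`B9.Thm311Printed c35Y geo9Y (bg9YR … R₁ R₂) (fun x => ((opsYOfLetters N θ M⋆ (lettersYOfRecordV4 N θ M⋆ 𝔯) 𝔈) x).PosDef)` — exactly the `t311` leaf
of MODULE 5-R's knit at `carriersYR … R₁ R₂ ops`.  The printed quantifiers are met with M₃ := M₁, a₀ := a₁; per member and configuration the landed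
chain `inputs311Y₄_of_posDefTr_deltaAY` → `inputs311Y₅_of_four` → `inputs311Y_of_five` → `inputs311_ops311Y` → `posDefOfOps_all` runs verbatim with
`hU.1.1 ↦ mem_of_reg335R hG x hU`. [cite: Balaban1985BackgroundPropagators, Thm 3.11 p.416 + (3.24)–(3.27) pp.394–395 + (3.35) p.396; Balaban1984PropagatorsI, p.25] -/
theorem t311_of_pins_opsYOfLettersV4₁R
    (hG : MemOfFam (specialUnitaryUnits (Fin N)) R₁) (a₁ M₁ : ℝ) (ha₁ : 0 < a₁) (hM₁ : 0 < M₁)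
    (hΔA : ∀ x : MemberY θ.d₆ θ.ℓ₆ θ.hd' θ.hL' θ.b₀ θ.b₁ Mstar, M₁ ≤ (geo9Y x).M → ∀ α₀ : ℝ, 0 < α₀ → (geo9Y x).M * α₀ ≤ a₁ →
      ∀ U : (bg9YR (Matrix (Fin N) (Fin N) ℂ) (specialUnitaryUnits (Fin N)) R₁ R₂ x).Cfg,
        (bg9YR (Matrix (Fin N) (Fin N) ℂ) (specialUnitaryUnits (Fin N)) R₁ R₂ x).Reg335 c35Y α₀ U →
          PosDefTr (fun _ => (1 : ℝ))
            (deltaAY x.toKIdx (parSymY x.toKIdx) (parBY x.toKIdx) (GpY x.toKIdx (parSymY x.toKIdx)) U))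
    (hPD : ∀ x : MemberY θ.d₆ θ.ℓ₆ θ.hd' θ.hL' θ.b₀ θ.b₁ Mstar,
      ((opsYOfLetters N θ Mstar (lettersYOfRecordV4 N θ Mstar 𝔯) 𝔈) x).PosDef
        = PosDefOfOps (ops311Y x (lettersYOfRecordV4 N θ Mstar 𝔯 x) (proofLettersOneV4 θ Mstar 𝔯 x))) :
    B9.Thm311Printed c35Y geo9Y (bg9YR (Matrix (Fin N) (Fin N) ℂ) (specialUnitaryUnits (Fin N)) R₁ R₂)
      (fun x => ((opsYOfLetters N θ Mstar (lettersYOfRecordV4 N θ Mstar 𝔯) 𝔈) x).PosDef) := by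
  refine ⟨M₁, a₁, hM₁, ha₁, fun x hM α₀ hα₀ hMa U hU n => ?_⟩
  have hMpos : 0 < (geo9Y x).M := lt_of_lt_of_le hM₁ hM
  have hUG : ∀ μ z, U μ z ∈ specialUnitaryUnits (Fin N) := fun μ z => mem_of_reg335R hG x hU μ z
  have h4 : Inputs311Y₄ x (lettersYOfRecordV4 N θ Mstar 𝔯 x) (proofLettersOneV4 θ Mstar 𝔯 x) 0 (geo9Y x).M U :=
    inputs311Y₄_of_posDefTr_deltaAY x (lettersYOfRecordV4 N θ Mstar 𝔯 x) rfl le_rfl hMpos.le (hΔA x hM α₀ hα₀ hMa U hU)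
  have h5 : Inputs311Y₅ x (lettersYOfRecordV4 N θ Mstar 𝔯 x) (proofLettersOneV4 θ Mstar 𝔯 x) 0 (geo9Y x).M U :=
    inputs311Y₅_of_four specialUnitaryUnits_le_unitaryUnits x (lettersYOfRecordV4 N θ Mstar 𝔯 x) (proofLettersOneV4 θ Mstar 𝔯 x)
      rfl hUG h4
  have h9 : Inputs311Y x (lettersYOfRecordV4 N θ Mstar 𝔯 x) (proofLettersOneV4 θ Mstar 𝔯 x) 0 (geo9Y x).M U :=
    inputs311Y_of_five specialUnitaryUnits_le_unitaryUnits x (lettersYOfRecordV4 N θ Mstar 𝔯 x) (proofLettersOneV4 θ Mstar 𝔯 x)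
      rfl rfl rfl rfl hUG h5
  have hI : Inputs311 (ops311Y x (lettersYOfRecordV4 N θ Mstar 𝔯 x) (proofLettersOneV4 θ Mstar 𝔯 x)) 0 (geo9Y x).M U :=
    inputs311_ops311Y rfl rfl h9
  have hgoal : PosDefOfOps (ops311Y x (lettersYOfRecordV4 N θ Mstar 𝔯 x) (proofLettersOneV4 θ Mstar 𝔯 x)) n U :=
    posDefOfOps_all _ hMpos (by rw [mul_zero]; exact hMpos.le) hI n
  have hPDx := congrFun (congrFun (hPD x) n) U
  exact Eq.mpr hPDx hgoal

/-- ★ **ROW 17 AT PRINT's CLASS** (`bg9YP`, MODULE 3-P): at `(R₁, R₂) := (regYP335, regYP336)` (`bg9YP_eq_bg9YR`, `memOfFam_regYP335`) the class-parametric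
face reads row 17 over print's cube class; there the clause `hΔA` follows from the principal coercivity alone
(`B9Eq335CoveragePAtLettersY.posDefTr_deltaAY_member_of_principal_P`). [cite: Balaban1985BackgroundPropagators, Thm 3.11 p.416 + (3.35) p.396 («a number ≧ 10»; bookkeeping)] -/
theorem t311_of_pins_opsYOfLettersV4₁_P (a₁ M₁ : ℝ) (ha₁ : 0 < a₁) (hM₁ : 0 < M₁)
    (hΔA : ∀ x : MemberY θ.d₆ θ.ℓ₆ θ.hd' θ.hL' θ.b₀ θ.b₁ Mstar, M₁ ≤ (geo9Y x).M → ∀ α₀ : ℝ, 0 < α₀ → (geo9Y x).M * α₀ ≤ a₁ →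
      ∀ U : (B9BackgroundsKLevelV1P.bg9YP (Matrix (Fin N) (Fin N) ℂ) (specialUnitaryUnits (Fin N)) x).Cfg,
        (B9BackgroundsKLevelV1P.bg9YP (Matrix (Fin N) (Fin N) ℂ) (specialUnitaryUnits (Fin N)) x).Reg335 c35Y α₀ U →
          PosDefTr (fun _ => (1 : ℝ))
            (deltaAY x.toKIdx (parSymY x.toKIdx) (parBY x.toKIdx) (GpY x.toKIdx (parSymY x.toKIdx)) U))
    (hPD : ∀ x : MemberY θ.d₆ θ.ℓ₆ θ.hd' θ.hL' θ.b₀ θ.b₁ Mstar,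
      ((opsYOfLetters N θ Mstar (lettersYOfRecordV4 N θ Mstar 𝔯) 𝔈) x).PosDef
        = PosDefOfOps (ops311Y x (lettersYOfRecordV4 N θ Mstar 𝔯 x) (proofLettersOneV4 θ Mstar 𝔯 x))) :
    B9.Thm311Printed c35Y geo9Y (B9BackgroundsKLevelV1P.bg9YP (Matrix (Fin N) (Fin N) ℂ) (specialUnitaryUnits (Fin N)))
      (fun x => ((opsYOfLetters N θ Mstar (lettersYOfRecordV4 N θ Mstar 𝔯) 𝔈) x).PosDef) :=
  t311_of_pins_opsYOfLettersV4₁R θ Mstar 𝔯 𝔈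
    (regYP335 (Matrix (Fin N) (Fin N) ℂ) (specialUnitaryUnits (Fin N))) (regYP336 (Matrix (Fin N) (Fin N) ℂ) (specialUnitaryUnits (Fin N)))
    memOfFam_regYP335 a₁ M₁ ha₁ hM₁ hΔA hPD

end Row17

end

end Literature.MathematicalPhysics.QuantumFieldTheory.Balaban1983to89.B9Thm39Thm311AtLettersR
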